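/-
Copyright (c) 2026 the pub-hodgecm-mathlib formalisation cell (harness21).  Prover seat hodgecm-mathlib-K2E1-p16 (g2), Track B «K2-LIT» ENGINE E1, h413 = `stmt-HodgeConjecture-24833`,
route `HCCMUnconditional`, R90-S8 «ContSpec-n½» #2∕#3 chain, deal S8-R103 (1) (S8 dealer R90-CS-plan (g2)), T1 CUT FILE 1: THE χ-PAIR INPUTS OF THE SECTION-GENERIC MAASS–SELBERG
RELATION ★ `maassSelberg_flatSectionU_cm_three_final'` — the two invariance letters and the first torus-average letter `hΞ₁`, DISCHARGED for `(χ₁, χ₂)`-sections.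
-/
import Summits.HodgeConjecture.HodgeConjecture.Theorems.K2E1CharacterEisensteinU3PairDefs   -- ★ (K2-defs1) `IsChiSectionPair`, `.borel_mul`, `.unipotent_mul`, `.toAdelic_mul`
import Summits.HodgeConjecture.HodgeConjecture.Theorems.K2E1BorelCosetsDictionary          -- ★ `forall_arithmeticBorel_iff`
import HarnessLib

/-!
# h413 ∕ R90-S8 T1 FILE 1 — `K2E1ChiMaassSelbergPairingsCMThree`: THE χ-PAIR INPUTS OF THE SECTION-GENERIC MAASS–SELBERG RELATION ON THE TUBE

Cell `pub/hodgecm-mathlib`, crux H413 = `stmt-HodgeConjecture-24833`; S8 dealer R90-CS-plan (g2) S8-R103 (1); census `K2/K2E1-p16/g2/CENSUS-T1.md`.  THEOREMS ONLY (no `def`, no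
`instance`, no notation, no named-fact hypothesis, no `sorry`); lane `--supports stmt-HodgeConjecture-24833 --as helper` (count-neutral).  Generic CM-type data `F E c` at `N = 3`.

THE MATHEMATICS ([MoeglinWaldspurger1995, II.1.7, IV.2.3]; [Arthur1980TraceFormulaII, §4]).  KEY FINDING of the census: the ★ Maass–Selberg relation on the convergence tube
`2 < Re z′ < Re z` for `U(2,1)` at the CM pair, ★ `K2E1MaassSelbergCMThreeFinal.maassSelberg_flatSectionU_cm_three_final'` (K2E4-p14), is SECTION-GENERIC: it holds for ANY continuous
bounded left-`N(𝔸)`- and left-`B(L⁺)`-invariant coefficients `φ, φ′` (`f = φ·H^z`), with named inputs EXACTLY the Siegel-region decay `hdec′` and the four `K_U`-AVERAGE identities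
`hΞ₁…hΞ₄` («`∫_K φ(t k)·conj φ′(t k) dμ_K = Ξ₁(d₀ t)` for `t ∈ T(𝔸)`», and the same with the intertwined coefficients).  Its four idelic brackets `[Ξᵢ]` ARE the three scalars of ★ p862892 ∕
★ p862829 (`a = [Ξ₁]`, `conj(w z′) = [Ξ₂]`, `w z = [Ξ₃]`, `B z z′ = [Ξ₄]`).  This file pays the χ-PAIR side of those inputs: for a `(χ₁, χ₂)`-section `φ` (★ `IsChiSectionPair`:
`φ(bg) = χ₁(b₀₀)·χ₂(b₁₁)·φ(g)`) with `χ₂` automorphic, the two invariances hold in final′'s exact spelling (§1: `N(𝔸)` through `unipotentInBorel = N(𝔸).subgroupOf B(𝔸)`, `B(L⁺)` through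
★ `forall_arithmeticBorel_iff`), and for two sections `φ, φ′` of the SAME pair with UNITARY `χ₁, χ₂` the torus translate drops out of the `K`-pairing:
`φ(t k)·conj φ′(t k) = |χ₁(t₀₀)|²|χ₂(t₁₁)|²·φ(k)·conj φ′(k) = φ(k)·conj φ′(k)`, so `hΞ₁` holds with the CONSTANT `Ξ₁ := ∫_K φ·conj φ′ dμ_K` (§2–§3) — whence `a = [Ξ₁] = (∫_K φ conj φ′)·∫_{‖x‖≤1} ‖x‖`,
`z`-INDEPENDENT, as ★ p862829 requires.
* §1 `chiPair_unipotentInBorel_mul`, `chiPair_arithmeticBorel_mul` — the two invariance letters of ★ final′ for pair sections.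
* §2 `chiPair_torus_mul_mul_conj`, **`torusAverage_chiPair_eq`** — the torus translate drops out of the `K`-pairing (any subgroup `K`, any measure).
* §3 HEAD **`xiOne_package_chiPair`** — the five `Ξ₁`-inputs of ★ final′ (measurable, bounded, principal-idele- and `ℝ_{>0}`-invariant, the average identity) for `Ξ₁ := const`, as ONE conjunction in
  final′'s bytes (generic subgroup `K ≤ G(𝔸)` and torus elements `t : torusInBorel`; `d₀ t = diagUnit _ 0`).
Remaining T1 letters (census): `hΞ₂ hΞ₃ hΞ₄` (FILE 2: intertwined pair sections ★ p861904 ⇒ idele-class character `χ₁·conj(reflectChar χ₁)` ⇒ ★ `bracket_character_eq_zero`∕`bracket_one`),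
`hdec′` (FILE 3), the road transfer `hFtube` (FILE 4).
HONEST LABEL: HC_CM is proved only modulo the 7 printed citations (2 remaining named inputs: hLiu418 = `stmt-HodgeConjecture-24832`, h413 = `stmt-HodgeConjecture-24833`) until rung 0
closes; this file asserts no named fact and closes no socket; count-neutral; visible letters: the pair-section property, `χ₂` automorphic, unitarity of `χ₁, χ₂`.

## References
* [MoeglinWaldspurger1995] C. Mœglin, J.-L. Waldspurger, *Spectral decomposition and Eisenstein series* (1995), II.1.7, IV.2.3.
* [Arthur1980TraceFormulaII] J. Arthur, *A trace formula for reductive groups II*, Compositio Math. 40 (1980), §4.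
* [Rogawski1990] J. D. Rogawski, *Automorphic Representations of Unitary Groups in Three Variables* (1990), §1.10, §13.9.
-/

set_option autoImplicit false
-- the mandated namespace repeats `HodgeConjecture.HodgeConjecture`, as in every `Theorems/*.lean` of this sub-problem
set_option linter.dupNamespace false

noncomputable section

open MeasureTheory Measure NumberField IsDedekindDomain Set
open scoped ENNReal NNReal ComplexConjugate
open Literature.NumberTheory Literature.NumberTheory.Automorphic Literature.NumberTheory.Automorphic.UnitaryGroup AdelicGroupData
open Literature.NumberTheory.Automorphic.Arthur2013.Leaves.TECR
open Literature.NumberTheory.GaloisRepresentations (HeckeCharacter)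
open Summit.HodgeConjecture.HodgeConjecture.Cruxes.H413.K2E1BorelEisensteinU
open Summit.HodgeConjecture.HodgeConjecture.Cruxes.H413.K2E1CharacterEisensteinU2Defs
open Summit.HodgeConjecture.HodgeConjecture.Cruxes.H413.K2E1CharacterEisensteinU3PairDefs
open Summit.HodgeConjecture.HodgeConjecture.Cruxes.H413.K2E1BorelCosetsDictionary (forall_arithmeticBorel_iff)

namespace Summit.HodgeConjecture.HodgeConjecture.Cruxes.H413.K2E1ChiMaassSelbergPairingsCMThree

variable {F E : Type} [Field F] [NumberField F] [Field E] [NumberField E] [Algebra F E] {c : E ≃ₐ[F] E}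
variable {χ₁ : HeckeCharacter E} {χ₂ : ↥(TorusDict.torus c) →ₜ* ℂˣ} {φ φ' : (quasiSplit F E c 3).Adelic → ℂ}

/-! ## §1 The two invariance letters of ★ final′ for pair sections -/

/-- **LEFT-`N(𝔸)`-INVARIANCE IN final′'s SPELLING** (`n : unipotentInBorel = N(𝔸).subgroupOf B(𝔸)`, coerced through `B(𝔸)`): ★ `IsChiSectionPair.unipotent_mul`.
[cite: MoeglinWaldspurger1995, II.1.7] -/
theorem chiPair_unipotentInBorel_mul (hφ : IsChiSectionPair χ₁ χ₂ φ) (n : ↥(unipotentInBorel F E c 3)) (y : (quasiSplit F E c 3).Adelic) :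
    φ (((n : borelAdelic F E c 3) : (quasiSplit F E c 3).Adelic) * y) = φ y :=
  hφ.unipotent_mul ⟨((n : borelAdelic F E c 3) : (quasiSplit F E c 3).Adelic), (mem_unipotentInBorel_iff (n : borelAdelic F E c 3)).1 n.2⟩ y

/-- **LEFT-`B(F)`-INVARIANCE IN final′'s SPELLING** (`b ∈ arithmeticBorel`), for `χ₂` automorphic: ★ `IsChiSectionPair.toAdelic_mul` through ★ `forall_arithmeticBorel_iff`.
[cite: MoeglinWaldspurger1995, II.1.7] -/
theorem chiPair_arithmeticBorel_mul (hφ : IsChiSectionPair χ₁ χ₂ φ) (hχ₂ : TorusDict.IsAutomorphic c χ₂) :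
    ∀ b ∈ arithmeticBorel F E c 3, ∀ y : (quasiSplit F E c 3).Adelic, φ ((b : (quasiSplit F E c 3).Adelic) * y) = φ y :=
  forall_arithmeticBorel_iff.2 (hφ.toAdelic_mul hχ₂)

/-! ## §2 The torus translate drops out of the `K`-pairing of two sections of the same unitary pair -/

/-- **`φ(t k)·conj φ′(t k) = φ(k)·conj φ′(k)`** for two `(χ₁, χ₂)`-sections of the SAME pair with `χ₁, χ₂` UNITARY and `t ∈ B(𝔸)` (in particular `t ∈ T(𝔸)`):
`φ(t k) = χ₁(t₀₀)χ₂(t₁₁)φ(k)` (★ `IsChiSectionPair.borel_mul`) and `|χ₁(t₀₀)χ₂(t₁₁)|² = 1`. [cite: MoeglinWaldspurger1995, II.1.7, IV.2.3] -/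
theorem chiPair_torus_mul_mul_conj (hφ : IsChiSectionPair χ₁ χ₂ φ) (hφ' : IsChiSectionPair χ₁ χ₂ φ')
    (hχ₁u : ∀ x, ‖((χ₁ x : ℂˣ) : ℂ)‖ = 1) (hχ₂u : ∀ u, ‖((χ₂ u : ℂˣ) : ℂ)‖ = 1)
    {b : (quasiSplit F E c 3).Adelic} (hb : b ∈ borelAdelic F E c 3) (k : (quasiSplit F E c 3).Adelic) :
    φ (b * k) * conj (φ' (b * k)) = φ k * conj (φ' k) := by
  rw [hφ.borel_mul hb k, hφ'.borel_mul hb k]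
  set c₁ : ℂ := ((χ₁ (firstEntryUnit hb) : ℂˣ) : ℂ) with hc₁
  set c₂ : ℂ := ((χ₂ (middleEntryUnitary hb) : ℂˣ) : ℂ) with hc₂
  have h1 : c₁ * conj c₁ = 1 := by rw [Complex.mul_conj, Complex.normSq_eq_norm_sq, hc₁, hχ₁u]; norm_num
  have h2 : c₂ * conj c₂ = 1 := by rw [Complex.mul_conj, Complex.normSq_eq_norm_sq, hc₂, hχ₂u]; norm_num
  rw [map_mul, map_mul]
  calc c₁ * c₂ * φ k * (conj c₁ * conj c₂ * conj (φ' k)) = (c₁ * conj c₁) * (c₂ * conj c₂) * (φ k * conj (φ' k)) := by ring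
    _ = φ k * conj (φ' k) := by rw [h1, h2, one_mul, one_mul]

variable [MeasurableSpace (quasiSplit F E c 3).Adelic]

/-- **THE TORUS TRANSLATE DROPS OUT OF THE `K`-PAIRING**: for every subgroup `K ≤ G(𝔸)`, every measure on it, and every `t ∈ T(𝔸) ≤ B(𝔸)`:
`∫_K φ(t k)·conj φ′(t k) dμ_K = ∫_K φ(k)·conj φ′(k) dμ_K` (two sections of the same unitary pair) — the `hΞ₁` identity of ★ final′ with a CONSTANT `Ξ₁`.
[cite: MoeglinWaldspurger1995, IV.2.3] -/
theorem torusAverage_chiPair_eq (hφ : IsChiSectionPair χ₁ χ₂ φ) (hφ' : IsChiSectionPair χ₁ χ₂ φ')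
    (hχ₁u : ∀ x, ‖((χ₁ x : ℂˣ) : ℂ)‖ = 1) (hχ₂u : ∀ u, ‖((χ₂ u : ℂˣ) : ℂ)‖ = 1)
    (K : Subgroup (quasiSplit F E c 3).Adelic) (μK : Measure ↥K) (t : ↥(torusInBorel F E c 3)) :
    ∫ k : ↥K, φ (((t : borelAdelic F E c 3) : (quasiSplit F E c 3).Adelic) * (k : (quasiSplit F E c 3).Adelic)) *
        conj (φ' (((t : borelAdelic F E c 3) : (quasiSplit F E c 3).Adelic) * (k : (quasiSplit F E c 3).Adelic))) ∂μK =
      ∫ k : ↥K, φ (k : (quasiSplit F E c 3).Adelic) * conj (φ' (k : (quasiSplit F E c 3).Adelic)) ∂μK :=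
  integral_congr_ae (Filter.Eventually.of_forall fun k => chiPair_torus_mul_mul_conj hφ hφ' hχ₁u hχ₂u (t : borelAdelic F E c 3).2 (k : (quasiSplit F E c 3).Adelic))

/-! ## §3 HEAD: the `Ξ₁`-package of ★ final′ for pair sections, with the constant `Ξ₁` -/

variable [MeasurableSpace (AdeleRing (𝓞 E) E)ˣ]

/-- **THE `hΞ₁` INPUTS OF ★ `maassSelberg_flatSectionU_cm_three_final'` FOR TWO SECTIONS OF THE SAME UNITARY PAIR, DISCHARGED WITH `Ξ₁ := ∫_K φ·conj φ′ dμ_K` (constant):**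
measurability, the bound `‖Ξ₁ x‖ ≤ ‖∫_K φ conj φ′‖`, invariance under principal ideles and under `ℝ_{>0}` (trivial for a constant), and the `K`-average identity (§2) — in final′'s bytes
(`t : torusInBorel`, argument `diagUnit t.2 0`), for every subgroup `K ≤ G(𝔸)` and measure `μ_K` (the consumer's `K = GL₃(𝒪̂_L) ∩ G(𝔸)` and its Haar measure).  Consequently the first
bracket of the relation is `[Ξ₁] = (∫_K φ conj φ′)·∫_{{‖x‖≤1}∩𝓕_I} ‖x‖ dν_I` — the `z`-independent scalar `a` of ★ `msBound_of_chiRelation`. [cite: MoeglinWaldspurger1995, IV.2.3] [cite: Arthur1980TraceFormulaII, §4] -/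
theorem xiOne_package_chiPair (hφ : IsChiSectionPair χ₁ χ₂ φ) (hφ' : IsChiSectionPair χ₁ χ₂ φ')
    (hχ₁u : ∀ x, ‖((χ₁ x : ℂˣ) : ℂ)‖ = 1) (hχ₂u : ∀ u, ‖((χ₂ u : ℂˣ) : ℂ)‖ = 1)
    (K : Subgroup (quasiSplit F E c 3).Adelic) (μK : Measure ↥K) :
    Measurable (fun _ : (AdeleRing (𝓞 E) E)ˣ => ∫ k : ↥K, φ (k : (quasiSplit F E c 3).Adelic) * conj (φ' (k : (quasiSplit F E c 3).Adelic)) ∂μK) ∧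
    (∀ x : (AdeleRing (𝓞 E) E)ˣ, ‖(fun _ : (AdeleRing (𝓞 E) E)ˣ => ∫ k : ↥K, φ (k : (quasiSplit F E c 3).Adelic) * conj (φ' (k : (quasiSplit F E c 3).Adelic)) ∂μK) x‖ ≤
      ‖∫ k : ↥K, φ (k : (quasiSplit F E c 3).Adelic) * conj (φ' (k : (quasiSplit F E c 3).Adelic)) ∂μK‖) ∧
    (∀ q ∈ GaloisRepresentations.principalIdeles E, ∀ x : (AdeleRing (𝓞 E) E)ˣ,
      (fun _ : (AdeleRing (𝓞 E) E)ˣ => ∫ k : ↥K, φ (k : (quasiSplit F E c 3).Adelic) * conj (φ' (k : (quasiSplit F E c 3).Adelic)) ∂μK) (q * x) =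
        (fun _ : (AdeleRing (𝓞 E) E)ˣ => ∫ k : ↥K, φ (k : (quasiSplit F E c 3).Adelic) * conj (φ' (k : (quasiSplit F E c 3).Adelic)) ∂μK) x) ∧
    (∀ (r : ℝ≥0ˣ) (x : (AdeleRing (𝓞 E) E)ˣ),
      (fun _ : (AdeleRing (𝓞 E) E)ˣ => ∫ k : ↥K, φ (k : (quasiSplit F E c 3).Adelic) * conj (φ' (k : (quasiSplit F E c 3).Adelic)) ∂μK) (posRealIdele E r * x) =
        (fun _ : (AdeleRing (𝓞 E) E)ˣ => ∫ k : ↥K, φ (k : (quasiSplit F E c 3).Adelic) * conj (φ' (k : (quasiSplit F E c 3).Adelic)) ∂μK) x) ∧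
    (∀ t : ↥(torusInBorel F E c 3),
      ∫ k : ↥K, φ (((t : borelAdelic F E c 3) : (quasiSplit F E c 3).Adelic) * (k : (quasiSplit F E c 3).Adelic)) *
          conj (φ' (((t : borelAdelic F E c 3) : (quasiSplit F E c 3).Adelic) * (k : (quasiSplit F E c 3).Adelic))) ∂μK =
        (fun _ : (AdeleRing (𝓞 E) E)ˣ => ∫ k : ↥K, φ (k : (quasiSplit F E c 3).Adelic) * conj (φ' (k : (quasiSplit F E c 3).Adelic)) ∂μK)
          (diagUnit (t : borelAdelic F E c 3).2 0)) :=
  ⟨measurable_const, fun _ => le_rfl, fun _ _ _ => rfl, fun _ _ => rfl, fun t => torusAverage_chiPair_eq hφ hφ' hχ₁u hχ₂u K μK t⟩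

end Summit.HodgeConjecture.HodgeConjecture.Cruxes.H413.K2E1ChiMaassSelbergPairingsCMThree

end
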